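import Summits.QuantumAdvantage.QuantumAdvantage.Theorems.HolonomyDialAvoid

/-!
# HolonomyDial — Flip (cell decomp-qadv, seat lens-2, generation 13; supports item 26531 `ExactnessDial.PolyLossOddU3`)

§S first half: `flip2` and its involution / odd-class / counting lemmas, `Wtot_flip12/23/13`, `hol_flip12/23/13`, the probe polynomials `U2P/U3P`, `e0P…e3P`.

Split (≤ 400 lines, part 6/11) of the node file `HOME/decomp-qadv-lens-2/g13/HolonomyDial.lean` (v5, sha256 fb2c0281…,
farm rc 0, no placeholders); declarations verbatim, namespace `Summit.QuantumAdvantage.QuantumAdvantage.Theorems.HolonomyDial`.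
Record: NODE-g13.md.
-/

set_option linter.dupNamespace false

noncomputable section
open scoped Classical

namespace Summit.QuantumAdvantage.QuantumAdvantage.Theorems

open Finset
open Literature.Computability.QuantumComplexity Literature.Computability.QuantumComplexity.RingHLF
open Literature.Computability.MetaComplexity Literature.Computability.MetaComplexity.Smolensky
open Summit.QuantumAdvantage.AdviceFreeQNC0
open Summit.QuantumAdvantage.QuantumAdvantage.Theses (ExactnessDial.PolyLossOddU3 ExactnessDial.NoPerfectOdd3
  ExactnessDial.NoPerfectConst3 ExactnessDial.MassStep3u ExactnessDial.OddToAll3 ExactnessDial.DPLift3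
  ExactnessDial.MultiRingBridge3 ExactnessDial.closes)

namespace HolonomyDial

/-! ## §S SEPARATE is as hard as DECODE — `BinPointerLoss3` PROVED by self-correction at the head

Four probes `y₀ = x`, `y₁ = x ⊕ e₁ ⊕ e₂`, `y₂ = x ⊕ e₂ ⊕ e₃`, `y₃ = x ⊕ e₁ ⊕ e₃` stay in the odd class and shift the
holonomy by `δ = (b - a) + Σ_{a ≤ i < b} u_i(x) (mod 3)`, a function of `x₀, x₁, x₂` only (`hol_flip12/23/13`). A pointer
winning at `y_j` refutes the hypothesis `e_j(x) = c(y_j) - δ_j(x)` for `hol(x)` (`avoidOfSep`); the four refuted values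
cover BOTH wrong hypotheses (finite check inside `decode_of_allWin`), so the polynomial `decV` = «the value missed by
`e₀, …, e₃`» (degree `10·D + 20`) decodes `hol(x)` wherever the pointer wins at all four probes. A union bound over the
four involutions of the odd class and `holDecode_hard_polylog` give `binPointerLoss3 : BinPointerLoss3` (loss `≥ 2^{-7}`).
Contrast (NOTES ## Barrier notes): plantings that move the MIDDLE block cannot extract anything pointwise — their shift
has an unknown sign `(-1)^{par(w)}`; the head flips have LOCAL, known shifts. -/

section SelfCorrect

variable {N : ℕ}

/-- flip two coordinates. -/
def flip2 (a b : ℕ) (x : Fin N → Bool) : Fin N → Bool := fun j => if j.val = a ∨ j.val = b then !x j else x j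

/-- Ring-game helper `flip2_flip2` (lens-2 law package; see the module docstring). -/
theorem flip2_flip2 (a b : ℕ) (x : Fin N → Bool) : flip2 a b (flip2 a b x) = x := by
  funext j
  simp only [flip2]
  split_ifs <;> simp

/-- Ring-game helper `flip2_apply_of_ne` (lens-2 law package; see the module docstring). -/
theorem flip2_apply_of_ne {a b : ℕ} (x : Fin N → Bool) {j : Fin N} (ha : j.val ≠ a) (hb : j.val ≠ b) :
    flip2 a b x j = x j := by
  simp only [flip2, ha, hb, or_self, if_false]

/-- Ring-game helper `flip2_zero` (lens-2 law package; see the module docstring). -/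
theorem flip2_zero {a b : ℕ} (ha : a ≠ 0) (hb : b ≠ 0) (x : Fin N → Bool) (hN : 0 < N) :
    flip2 a b x ⟨0, hN⟩ = x ⟨0, hN⟩ :=
  flip2_apply_of_ne x (show (0 : ℕ) ≠ a by omega) (show (0 : ℕ) ≠ b by omega)

/-- prefix zero-parities of a double flip: flipped exactly on `(a, b]`. -/
theorem zpar_flip2 {a b : ℕ} (hab : a < b) (x : Fin N → Bool) :
    ∀ k, k ≤ N → zpar (flip2 a b x) k = if a < k ∧ k ≤ b then !zpar x k else zpar x k := by
  intro k hk
  induction k with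
  | zero => rw [zpar_zero, zpar_zero, if_neg (by omega)]
  | succ k ih =>
    have hkN : k < N := by omega
    rw [zpar_succ _ hkN, zpar_succ _ hkN, ih (by omega)]
    simp only [flip2]
    generalize zpar x k = p
    generalize x ⟨k, hkN⟩ = q
    split_ifs <;> first | omega | (cases p <;> cases q <;> rfl)

/-- Ring-game helper `oddZeros_iff_zpar` (lens-2 law package; see the module docstring). -/
theorem oddZeros_iff_zpar (x : Fin N → Bool) : OddZeros x ↔ zpar x N = true := by
  unfold OddZeros zpar
  rw [decide_eq_true_iff]
  have e : (univ.filter fun j : Fin N => j.val < N ∧ x j = false) = univ.filter fun j : Fin N => x j = false :=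
    Finset.filter_congr fun j _ => ⟨fun h => h.2, fun h => ⟨j.isLt, h⟩⟩
  rw [e]

/-- Ring-game helper `oddZeros_flip2` (lens-2 law package; see the module docstring). -/
theorem oddZeros_flip2 {a b : ℕ} (hab : a < b) (hbN : b < N) (x : Fin N → Bool) :
    OddZeros (flip2 a b x) ↔ OddZeros x := by
  rw [oddZeros_iff_zpar, oddZeros_iff_zpar, zpar_flip2 hab x N le_rfl, if_neg (show ¬ (a < N ∧ N ≤ b) by omega)]

/-- the odd class is invariant under a double flip (counting version). -/
theorem card_filter_flip2 {a b : ℕ} (hab : a < b) (hbN : b < N) (P : (Fin N → Bool) → Prop) :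
    (univ.filter fun x : Fin N → Bool => OddZeros x ∧ P (flip2 a b x)).card =
      (univ.filter fun x : Fin N → Bool => OddZeros x ∧ P x).card := by
  refine Finset.card_bij (fun x _ => flip2 a b x) (fun x hx => ?_) (fun x₁ _ x₂ _ h => ?_) (fun y hy => ?_)
  · rw [mem_filter] at hx ⊢
    exact ⟨mem_univ _, (oddZeros_flip2 hab hbN x).2 hx.2.1, hx.2.2⟩
  · have h' := congrArg (flip2 a b) h
    simpa only [flip2_flip2] using h'
  · refine ⟨flip2 a b y, ?_, flip2_flip2 a b y⟩
    rw [mem_filter] at hy ⊢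
    refine ⟨mem_univ _, (oddZeros_flip2 hab hbN _).2 hy.2.1, ?_⟩
    rw [flip2_flip2]; exact hy.2.2

/-- composing with a double flip keeps the degree. -/
theorem comp_flip2_mem (a b : ℕ) {D : ℕ} {P : CubeFn (ZMod 3) N} (hP : P ∈ lowDeg (ZMod 3) N D) :
    (fun x => P (flip2 a b x)) ∈ lowDeg (ZMod 3) N D := by
  refine Smolensky.comp_mem_lowDeg_of_coord (F := ZMod 3) (flip2 a b) (fun i => ?_) hP
  by_cases hi : i.val = a ∨ i.val = b
  · have e : (fun u : Fin N → Bool => if flip2 a b u i = true then (1 : ZMod 3) else 0) = 1 - mono (ZMod 3) {i} := by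
      funext u
      simp only [flip2, if_pos hi, Pi.sub_apply, Pi.one_apply, mono_singleton_apply]
      cases u i <;> simp
    rw [e]; exact Submodule.sub_mem _ (one_mem_lowDeg 1) (mono_mem_lowDeg (by simp))
  · have e : (fun u : Fin N → Bool => if flip2 a b u i = true then (1 : ZMod 3) else 0) = mono (ZMod 3) {i} := by
      funext u
      simp only [flip2, if_neg hi, mono_singleton_apply]
    rw [e]; exact mono_mem_lowDeg (by simp)

/-! ### the head phases `x₀, u₁ = zpar 2, u₂ = zpar 3` and the holonomy shifts of the probes -/

/-- Ring-game helper `zpar_two` (lens-2 law package; see the module docstring). -/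
theorem zpar_two (x : Fin N → Bool) (hN : 3 ≤ N) :
    zpar x 2 = xor (x ⟨0, by omega⟩) (x ⟨1, by omega⟩) := by
  have h := (walk_block x 0 (by omega)).2.1
  rw [zpar_zero] at h
  have h' : zpar x 2 = xor (xor false (!x ⟨0, by omega⟩)) (!x ⟨1, by omega⟩) := h
  rw [h']
  cases x ⟨0, by omega⟩ <;> cases x ⟨1, by omega⟩ <;> rfl

/-- Ring-game helper `zpar_three` (lens-2 law package; see the module docstring). -/
theorem zpar_three (x : Fin N → Bool) (hN : 3 ≤ N) :
    zpar x 3 = !(xor (xor (x ⟨0, by omega⟩) (x ⟨1, by omega⟩)) (x ⟨2, by omega⟩)) := by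
  have h := (walk_block x 0 (by omega)).2.2.1
  rw [zpar_zero] at h
  have h' : zpar x 3 = xor (xor (xor false (!x ⟨0, by omega⟩)) (!x ⟨1, by omega⟩)) (!x ⟨2, by omega⟩) := h
  rw [h']
  cases x ⟨0, by omega⟩ <;> cases x ⟨1, by omega⟩ <;> cases x ⟨2, by omega⟩ <;> rfl

/-- Ring-game helper `Wk_four` (lens-2 law package; see the module docstring). -/
theorem Wk_four (x : Fin N → Bool) (hN : 4 ≤ N) :
    Wk x 4 = (if zpar x 1 then 1 else 0) + (if zpar x 2 then 1 else 0) + (if zpar x 3 then 1 else 0) +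
      (if zpar x 4 then 1 else 0) := by
  have hb := (walk_block x 0 (by omega)).2.2.2
  rw [Wk_zero] at hb
  have hb' : Wk x 3 = 0 + (if zpar x 1 then 1 else 0) + (if zpar x 2 then 1 else 0) + (if zpar x 3 then 1 else 0) := hb
  have h4 := Wk_succ x (k := 3) (by omega)
  rw [uCoord_eq_zpar] at h4
  have h4' : Wk x 4 = Wk x 3 + (if zpar x 4 then 1 else 0) := h4
  rw [h4', hb']
  simp

/-- the weight shifts of the three probes (`u_1 = zpar 2`, `u_2 = zpar 3`). -/
theorem Wtot_flip12 (x : Fin N → Bool) (hN : 5 ≤ N) :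
    Wtot (flip2 1 2 x) + 2 * (if zpar x 2 then 1 else 0) = Wtot x + 1 := by
  have hz := zpar_flip2 (show 1 < 2 by norm_num) x
  have hag := (walk_agree (flip2 1 2 x) x 4 (N - 1) (by omega)
    (by rw [hz 4 (by omega), if_neg (show ¬ (1 < 4 ∧ 4 ≤ 2) by omega)])
    (fun j hj _ => flip2_apply_of_ne x (by omega) (by omega)) (N - 1) (by omega) le_rfl).2
  have h4x := Wk_four x (by omega)
  have h4y := Wk_four (flip2 1 2 x) (by omega)
  rw [hz 1 (by omega), hz 2 (by omega), hz 3 (by omega), hz 4 (by omega),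
    if_neg (show ¬ (1 < 1 ∧ 1 ≤ 2) by omega), if_pos (show (1 < 2 ∧ 2 ≤ 2) by omega),
    if_neg (show ¬ (1 < 3 ∧ 3 ≤ 2) by omega), if_neg (show ¬ (1 < 4 ∧ 4 ≤ 2) by omega)] at h4y
  unfold Wtot
  cases h1 : zpar x 1 <;> cases h2 : zpar x 2 <;> cases h3 : zpar x 3 <;> cases h4 : zpar x 4 <;>
    simp [h1, h2, h3, h4] at h4x h4y ⊢ <;> omega

/-- Ring-game helper `Wtot_flip23` (lens-2 law package; see the module docstring). -/
theorem Wtot_flip23 (x : Fin N → Bool) (hN : 5 ≤ N) :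
    Wtot (flip2 2 3 x) + 2 * (if zpar x 3 then 1 else 0) = Wtot x + 1 := by
  have hz := zpar_flip2 (show 2 < 3 by norm_num) x
  have hag := (walk_agree (flip2 2 3 x) x 4 (N - 1) (by omega)
    (by rw [hz 4 (by omega), if_neg (show ¬ (2 < 4 ∧ 4 ≤ 3) by omega)])
    (fun j hj _ => flip2_apply_of_ne x (by omega) (by omega)) (N - 1) (by omega) le_rfl).2
  have h4x := Wk_four x (by omega)
  have h4y := Wk_four (flip2 2 3 x) (by omega)
  rw [hz 1 (by omega), hz 2 (by omega), hz 3 (by omega), hz 4 (by omega),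
    if_neg (show ¬ (2 < 1 ∧ 1 ≤ 3) by omega), if_neg (show ¬ (2 < 2 ∧ 2 ≤ 3) by omega),
    if_pos (show (2 < 3 ∧ 3 ≤ 3) by omega), if_neg (show ¬ (2 < 4 ∧ 4 ≤ 3) by omega)] at h4y
  unfold Wtot
  cases h1 : zpar x 1 <;> cases h2 : zpar x 2 <;> cases h3 : zpar x 3 <;> cases h4 : zpar x 4 <;>
    simp [h1, h2, h3, h4] at h4x h4y ⊢ <;> omega

/-- Ring-game helper `Wtot_flip13` (lens-2 law package; see the module docstring). -/
theorem Wtot_flip13 (x : Fin N → Bool) (hN : 5 ≤ N) :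
    Wtot (flip2 1 3 x) + 2 * ((if zpar x 2 then 1 else 0) + (if zpar x 3 then 1 else 0)) = Wtot x + 2 := by
  have hz := zpar_flip2 (show 1 < 3 by norm_num) x
  have hag := (walk_agree (flip2 1 3 x) x 4 (N - 1) (by omega)
    (by rw [hz 4 (by omega), if_neg (show ¬ (1 < 4 ∧ 4 ≤ 3) by omega)])
    (fun j hj _ => flip2_apply_of_ne x (by omega) (by omega)) (N - 1) (by omega) le_rfl).2
  have h4x := Wk_four x (by omega)
  have h4y := Wk_four (flip2 1 3 x) (by omega)
  rw [hz 1 (by omega), hz 2 (by omega), hz 3 (by omega), hz 4 (by omega),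
    if_neg (show ¬ (1 < 1 ∧ 1 ≤ 3) by omega), if_pos (show (1 < 2 ∧ 2 ≤ 3) by omega),
    if_pos (show (1 < 3 ∧ 3 ≤ 3) by omega), if_neg (show ¬ (1 < 4 ∧ 4 ≤ 3) by omega)] at h4y
  unfold Wtot
  cases h1 : zpar x 1 <;> cases h2 : zpar x 2 <;> cases h3 : zpar x 3 <;> cases h4 : zpar x 4 <;>
    simp [h1, h2, h3, h4] at h4x h4y ⊢ <;> omega

/-- Ring-game helper `hol_flip12` (lens-2 law package; see the module docstring). -/
theorem hol_flip12 (x : Fin N → Bool) (hN : 5 ≤ N) :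
    hol (flip2 1 2 x) = (hol x + 1 + (if zpar x 2 then 1 else 0)) % 3 := by
  have h := Wtot_flip12 x hN
  unfold hol
  cases h2 : zpar x 2 <;> simp [h2] at h ⊢ <;> omega

/-- Ring-game helper `hol_flip23` (lens-2 law package; see the module docstring). -/
theorem hol_flip23 (x : Fin N → Bool) (hN : 5 ≤ N) :
    hol (flip2 2 3 x) = (hol x + 1 + (if zpar x 3 then 1 else 0)) % 3 := by
  have h := Wtot_flip23 x hN
  unfold hol
  cases h3 : zpar x 3 <;> simp [h3] at h ⊢ <;> omega

/-- Ring-game helper `hol_flip13` (lens-2 law package; see the module docstring). -/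
theorem hol_flip13 (x : Fin N → Bool) (hN : 5 ≤ N) :
    hol (flip2 1 3 x) = (hol x + 2 + (if zpar x 2 then 1 else 0) + (if zpar x 3 then 1 else 0)) % 3 := by
  have h := Wtot_flip13 x hN
  unfold hol
  cases h2 : zpar x 2 <;> cases h3 : zpar x 3 <;> simp [h2, h3] at h ⊢ <;> omega

/-! ### the decoder polynomial -/

/-- `[u_1] = [zpar 2] = [x_0 ⊕ x_1]` as a polynomial. -/
def U2P (hN : 3 ≤ N) : CubeFn (ZMod 3) N :=
  mono (ZMod 3) {(⟨0, by omega⟩ : Fin N)} + mono (ZMod 3) {(⟨1, by omega⟩ : Fin N)} +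
    mono (ZMod 3) {(⟨0, by omega⟩ : Fin N)} * mono (ZMod 3) {(⟨1, by omega⟩ : Fin N)}

/-- Ring-game helper `U2P_mem` (lens-2 law package; see the module docstring). -/
theorem U2P_mem (hN : 3 ≤ N) : U2P hN ∈ lowDeg (ZMod 3) N 2 := by
  unfold U2P
  refine Submodule.add_mem _ (Submodule.add_mem _ ?_ ?_) ?_
  · exact mono_mem_lowDeg (D := 2) (by simp)
  · exact mono_mem_lowDeg (D := 2) (by simp)
  · exact mul_mem_lowDeg_add (D := 1) (D' := 1) (mono_mem_lowDeg (by simp)) (mono_mem_lowDeg (by simp))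

/-- Ring-game helper `U2P_apply` (lens-2 law package; see the module docstring). -/
theorem U2P_apply (hN : 3 ≤ N) (x : Fin N → Bool) : U2P hN x = if zpar x 2 then 1 else 0 := by
  rw [zpar_two x hN]
  simp only [U2P, Pi.add_apply, Pi.mul_apply, mono_singleton_apply]
  exact xor_indicator_bool _ _

/-- `[u_2] = [zpar 3] = ¬[x_0 ⊕ x_1 ⊕ x_2]` as a polynomial. -/
def U3P (hN : 3 ≤ N) : CubeFn (ZMod 3) N := 1 - xorP (U2P hN) (mono (ZMod 3) {(⟨2, by omega⟩ : Fin N)})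

/-- Ring-game helper `U3P_mem` (lens-2 law package; see the module docstring). -/
theorem U3P_mem (hN : 3 ≤ N) : U3P hN ∈ lowDeg (ZMod 3) N 3 := by
  have h : xorP (U2P hN) (mono (ZMod 3) {(⟨2, by omega⟩ : Fin N)}) ∈ lowDeg (ZMod 3) N (2 + 1) :=
    xorP_mem (U2P_mem hN) (mono_mem_lowDeg (D := 1) (by simp))
  exact Submodule.sub_mem _ (one_mem_lowDeg 3) (lowDeg_mono (by norm_num) h)

/-- Ring-game helper `U3P_apply` (lens-2 law package; see the module docstring). -/
theorem U3P_apply (hN : 3 ≤ N) (x : Fin N → Bool) : U3P hN x = if zpar x 3 then 1 else 0 := by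
  have h := xorP_apply_bool (U2P hN) (mono (ZMod 3) {(⟨2, by omega⟩ : Fin N)}) x (zpar x 2) (x ⟨2, by omega⟩)
    (U2P_apply hN x) (mono_singleton_apply _ x)
  rw [zpar_two x hN] at h
  simp only [U3P, Pi.sub_apply, Pi.one_apply, h]
  rw [zpar_three x hN]
  cases x ⟨0, by omega⟩ <;> cases x ⟨1, by omega⟩ <;> cases x ⟨2, by omega⟩ <;> decide

/-- Ring-game helper `avoidOfSep_apply'` (lens-2 law package; see the module docstring). -/
theorem avoidOfSep_apply' (hN : 0 < N) (f : CubeFn (ZMod 3) N) (x : Fin N → Bool) :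
    avoidOfSep hN f x = if decide (f x = 1) then 2 else if x ⟨0, hN⟩ = false then 0 else 1 := by
  rw [avoidOfSep_apply]
  by_cases h : f x = 1 <;> simp [h]

/-- the refuted hypotheses read off the four probes, as polynomials. -/
def e0P (h0 : 0 < N) (f : CubeFn (ZMod 3) N) : CubeFn (ZMod 3) N := avoidOfSep h0 f

/-- Ring-game helper `e1P` (lens-2 law package; see the module docstring). -/
def e1P (h0 : 0 < N) (hN : 3 ≤ N) (f : CubeFn (ZMod 3) N) : CubeFn (ZMod 3) N :=
  (fun x => avoidOfSep h0 f (flip2 1 2 x)) - (1 + U2P hN)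

/-- Ring-game helper `e2P` (lens-2 law package; see the module docstring). -/
def e2P (h0 : 0 < N) (hN : 3 ≤ N) (f : CubeFn (ZMod 3) N) : CubeFn (ZMod 3) N :=
  (fun x => avoidOfSep h0 f (flip2 2 3 x)) - (1 + U3P hN)

/-- Ring-game helper `e3P` (lens-2 law package; see the module docstring). -/
def e3P (h0 : 0 < N) (hN : 3 ≤ N) (f : CubeFn (ZMod 3) N) : CubeFn (ZMod 3) N :=
  (fun x => avoidOfSep h0 f (flip2 1 3 x)) - (1 + 1 + U2P hN + U3P hN)
end SelfCorrect

end HolonomyDial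

end Summit.QuantumAdvantage.QuantumAdvantage.Theorems
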